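import Literature.InformationTheory.QuantumCodes.CSSEquivalence
import Literature.InformationTheory.QuantumCodes.AbelianTwoBlockParameters
import HarnessLib

/-!
# Hyperbicycle CSS codes (Kovalev–Pryadko 2013): the check matrices with the block-shift twist `χ`,
# the CSS condition (proved), the block length, and the `χ`-triviality of the two-sided formula

Source: A. A. Kovalev, L. P. Pryadko, *Quantum Kronecker sum-product low-density parity-check codes with
finite rate*, Phys. Rev. A **88** (2013) 012311 = arXiv:1212.6703 [KovalevPryadko2013Hyperbicycle]. The
HELD text is the arXiv v2 TeX (`lit read paper:arxiv-1212.6703`, 22 chunks; v2 of 2 Jan 2013 is the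
latest arXiv version); every locator "chunk pNNNN Lnn" below refers to it. The journal text is not held
(qec acquisition request acq-12359).

## What is printed, and what this file types

§IV.A eq. (19) [chunk p0009 L15-22] defines the hyperbicycle CSS code by
`G_X = (E_b ⊗ Σᵢ Iᵢ^(χ) ⊗ aᵢ , Σᵢ bᵢ ⊗ Iᵢ^(χ) ⊗ E_a)`, `G_Z = (Σᵢ bᵢᵀ ⊗ Ĩᵢ^(χ) ⊗ Ẽ_a , Ẽ_b ⊗ Σᵢ Ĩᵢ^(χ) ⊗ aᵢᵀ)`
with binary blocks `aᵢ` (`r₁ × n₁`) and `bᵢ` (`r₂ × n₂`), `i = 0, …, c − 1`, unit matrices `E_a, E_b, Ẽ_a,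
Ẽ_b` of sizes `r₁, r₂, n₁, n₂` [p0009 L24-28], `(Iᵢ)_{kj} = δ_{j−k,i mod c}` the circulant permutation
matrices, `c` and `χ` coprime [p0009 L28-33], block length `N = c (r₁n₂ + r₂n₁)` [p0009 L40-42], and the
remark "The commutativity condition `G_X G_Zᵀ = 0` is obviously satisfied by Eq. (19) since the
permutation matrices commute with each other" [p0009 L45-47]; `c = 1` recovers the hypergraph product and
`rᵢ = nᵢ = 1` the generalized bicycle codes [p0009 L47-51].

THE TWIST. The printed text realises `Iᵢ^(χ)` as `S_χ Iᵢ` with the multiplier permutation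
`(S_χ)_{kj} = δ_{j−k,(k−1)(χ−1) mod c}` (0-indexed: `j = χk`) in BOTH blocks [p0009 L29-33, and eq. (23)
"`𝓗₁ = S_χ ⊗ E_a · 𝓗₁⁰, 𝓗₂ = E_b ⊗ S_χ · 𝓗₂⁰`", p0009 L85-90]. Read literally this makes
`G_X^(χ) = (E ⊗ S_χ ⊗ E) · G_X^(1)` and `G_Z^(χ) = (E ⊗ S_χᵀ ⊗ E) · G_Z^(1)` — a common ROW PERMUTATION,
so the code does not depend on `χ` at all (the paper itself: "The parameter `χ` does not enter this
discussion since it corresponds to permutations of rows", p0010 L98-100), whereas §IV.F–G and Examples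
7–12 [p0015 L45-48, p0016 L1-53] use `χ` to change the parameters (Ex. 10: `[[126,8,10]]` for `χ = 3`
vs `[[126,14,6]]` for `χ = 1`). The object those examples describe is the code with "one of the periodic
boundaries shifted by `χ` blocks" [p0015 L45-48]: in the notation of eq. (19), the circulant POWER
`I_{χi}` (shift by `χ·i`; the paper writes "`I_{χi}`" at p0010 L4) applied in ONE of the two blocks —
this reproduces all eleven printed `(N, K)` of Examples 7–12 and coincides, under an explicit qubit
relabelling, with the `ℤ_c`-quotient reconstruction used by the qec census (lit-3 register
`KP13-EQ19-NOTE.md`, 2026-08-27, with the numerical evidence; qec-search-4 note of 2026-08-26). This file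
therefore types:

* `Hyperbicycle.xMatrix a b χ`, `Hyperbicycle.zMatrix a b χ` — eq. (19) with the twist `I_{χi}` on the
  `b`-block (`χ` a unit of `ℤ_c`, i.e. `gcd(c, χ) = 1` as printed), as explicit block matrices
  `[E_b ⊗ Σᵢ Iᵢ ⊗ aᵢ | Σᵢ bᵢ ⊗ I_{χi} ⊗ E_a]`, `[Σᵢ bᵢᵀ ⊗ I_{χi}ᵀ ⊗ Ẽ_a | Ẽ_b ⊗ Σᵢ Iᵢᵀ ⊗ aᵢᵀ]`; rows of
  `G_X` are indexed by `R₂ × ℤ_c × R₁` (the Kronecker triple `(β, k, u)`), rows of `G_Z` by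
  `N₂ × ℤ_c × N₁`, qubits by `(R₂ × ℤ_c × N₁) ⊕ (N₂ × ℤ_c × R₁)`; DEFINITIONS (computable, closed-form
  entries), with the lemmas `xLeft_eq_kronecker`, `xRight_eq_kronecker` saying the entries ARE those of the
  displayed Kronecker sums; `χ = 1` is the untwisted code (= the printed formula for `χ = 1`, for which the
  two readings agree).
* `Hyperbicycle.xMatrix_mul_zMatrix_transpose` — the CSS condition `G_X G_Zᵀ = 0` for ARBITRARY blocks
  `aᵢ, bᵢ` and every unit `χ` (both block products equal `Σⱼ a_{j−k} ⊗ b_{χ⁻¹(k'−j)}` entrywise and cancel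
  in characteristic 2); PROVED. `Hyperbicycle.code a b χ : CSSCode`.
* `Hyperbicycle.card_qubits` — `N = c (r₂n₁ + n₂r₁)`; PROVED.
* `Hyperbicycle.litXMatrix / litZMatrix / litCode` — the LITERAL two-sided reading (`S_χ Iᵢ` in both
  blocks: `X`-entries `a_{j−χk}`, `b_{j−χk}`, `Z`-entries `b_{χ⁻¹k'−j}`, `a_{χ⁻¹k'−j}`), with
  `litXLeft_eq_kronecker` / `litZRight_eq_kronecker` (its blocks ARE `E_b ⊗ Σᵢ (S_χ Iᵢ) ⊗ aᵢ`,
  `Ẽ_b ⊗ Σᵢ (S_χᵀ Iᵢᵀ) ⊗ aᵢᵀ` as printed), the identities `litXMatrix = (xMatrix a b 1).submatrix ρ id`,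
  `litZMatrix = (zMatrix a b 1).submatrix ρ' id` along the row bijections `(β,k,u) ↦ (β,χk,u)`,
  `(ν,k',μ) ↦ (ν,χ⁻¹k',μ)`, and hence
  `litCode_isCode_iff : (litCode a b χ).IsCode n k d ↔ (code a b 1).IsCode n k d`, `litCode_dX/dZ/k` —
  the `χ`-TRIVIALITY of the formula as printed; PROVED (this is a theorem about the printed formula, not
  a claim of the paper).
* `Hyperbicycle.squareBlocks`, `Hyperbicycle.squareCode h n χ` — the "two circulant matrices" family of
  §IV.G [p0015 L62-70, p0016]: `aᵢ = bᵢ =` the `n × n` blocks of the `cn × cn` circulant of `h`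
  (`B(h)_{pq} = h_{p−q}`), `N = 2cn²`; the census objects `HB40` (Ex. 7: `h = 1+x, n = 2, c = 5, χ = 3`,
  `[[40,2,6]]`), `HB90b` (Ex. 8), `HB120w6` (Ex. 12) of `Summits/Ventures/QEC/Census/HB/` are — up to the
  qubit relabelling recorded in `KP13-EQ19-NOTE.md` §4 — instances of `squareCode`; their printed
  parameters are CLAIMS discharged there by certificate, and nothing about them is asserted here.

## What is NOT here
KP13 Theorem 3 (dimension count), Theorems 5/6 (distance bounds) and Consequence 4 are NOT typed: as
printed they are `χ`-free statements about "the code with generators (19)", i.e. about the `χ`-trivial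
literal object (`= code a b 1` here; Panteleev–Kalachev, IEEE TIT 68 (2022) = arXiv:2012.04068 §3.5,
chunk p0012 L61, use Theorem 3 exactly for `χ = 1`), and typing them for the twisted codes would assert
more than is printed. No parameter `[[N,K,d]]` of any example is asserted. The identification of
`squareCode` with the census matrices is an index identity for the certificate emitter, not a theorem of
this file.
-/

namespace Literature.InformationTheory.QuantumCodes

namespace Hyperbicycle

open Matrix
open scoped Kronecker

variable {c : ℕ} [NeZero c]
variable {R₁ N₁ R₂ N₂ : Type*}
variable [Fintype R₁] [Fintype N₁] [Fintype R₂] [Fintype N₂]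
variable [DecidableEq R₁] [DecidableEq N₁] [DecidableEq R₂] [DecidableEq N₂]

/-! ### The permutation matrices of eq. (19) -/

/-- The circulant permutation matrix `I_s` of size `c`: `(I_s)_{kj} = δ_{j−k,s}` ("`(Iᵢ)_{kj} = δ_{j−k, i mod c}`
is a circulant permutation matrix"); indices in `ℤ_c`. `I_{χi}` is `cycPerm (χ * i)`. Definition.
[cite: KovalevPryadko2013Hyperbicycle, §IV.A eq. (19) (arXiv:1212.6703 chunk p0009 L29-31)] -/
def cycPerm (s : ZMod c) : Matrix (ZMod c) (ZMod c) (ZMod 2) :=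
  Matrix.of fun k j => if j = k + s then 1 else 0

/-- The multiplier permutation matrix `S_χ`: `(S_χ)_{kj} = δ_{j−k,(k−1)(χ−1) mod c}` in the paper's
1-based indices, i.e. `j = χ·k` 0-based (`j − 1 = χ (k − 1)`); a permutation matrix iff `gcd(c, χ) = 1`.
Definition. [cite: KovalevPryadko2013Hyperbicycle, §IV.A eq. (19) (arXiv:1212.6703 chunk p0009 L31-33)] -/
def mulPerm (χ : ZMod c) : Matrix (ZMod c) (ZMod c) (ZMod 2) :=
  Matrix.of fun k j => if j = χ * k then 1 else 0

omit [NeZero c] in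
/-- Entry of `I_s`. [cite: KovalevPryadko2013Hyperbicycle, §IV.A eq. (19) (arXiv:1212.6703 chunk p0009 L29-31)] -/
@[simp] theorem cycPerm_apply (s k j : ZMod c) : cycPerm s k j = if j = k + s then 1 else 0 := rfl

/-- The printed twisted permutation `Iᵢ^(χ) = S_χ Iᵢ` has entries `δ_{j, χk + i}`.
[cite: KovalevPryadko2013Hyperbicycle, §IV.A eq. (19) (arXiv:1212.6703 chunk p0009 L29-33)] -/
theorem mulPerm_mul_cycPerm_apply (χ i k j : ZMod c) :
    (mulPerm χ * cycPerm i) k j = if j = χ * k + i then 1 else 0 := by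
  simp only [mul_apply, mulPerm, cycPerm, of_apply, ite_mul, one_mul, zero_mul, Finset.sum_ite_eq',
    Finset.mem_univ, if_true]

/-- The printed `Z`-side permutation `Ĩᵢ^(χ) = S_χᵀ Iᵢᵀ` has entries `δ_{k', χ(j + i)}`.
[cite: KovalevPryadko2013Hyperbicycle, §IV.A eq. (19) (arXiv:1212.6703 chunk p0009 L29-33)] -/
theorem transpose_mulPerm_mul_transpose_cycPerm_apply (χ i k' j : ZMod c) :
    ((mulPerm χ)ᵀ * (cycPerm i)ᵀ) k' j = if k' = χ * (j + i) then 1 else 0 := by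
  rw [← transpose_mul, transpose_apply]
  simp only [mul_apply, mulPerm, cycPerm, of_apply, ite_mul, one_mul, zero_mul, Finset.sum_ite_eq',
    Finset.mem_univ, if_true]

/-- Collapse of the block sum `Σᵢ [j = k + χ·i] fᵢ` for a unit `χ`: the unique index is `i = χ⁻¹(j − k)`.
[cite: KovalevPryadko2013Hyperbicycle, §IV.A eq. (19) (arXiv:1212.6703 chunk p0009 L29-33)] -/
theorem sum_ite_eq_add_mul (χ : (ZMod c)ˣ) (k j : ZMod c) (f : ZMod c → ZMod 2) :
    (∑ i : ZMod c, if j = k + (χ : ZMod c) * i then f i else 0) = f (↑χ⁻¹ * (j - k)) := by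
  rw [Finset.sum_eq_single (↑χ⁻¹ * (j - k))]
  · rw [if_pos (by rw [Units.mul_inv_cancel_left]; abel)]
  · intro i _ hi
    refine if_neg fun h => hi ?_
    rw [h, add_sub_cancel_left, Units.inv_mul_cancel_left]
  · intro h
    exact absurd (Finset.mem_univ _) h

/-! ### The four blocks of eq. (19), with the twist `I_{χi}` on the `b`-block -/

/-- Left block of `G_X`: `E_b ⊗ Σᵢ Iᵢ ⊗ aᵢ`, rows `(β, k, u) ∈ R₂ × ℤ_c × R₁`, columns
`(β', j, v) ∈ R₂ × ℤ_c × N₁`, entry `δ_{ββ'} · (a_{j−k})_{uv}`. Definition (closed form; `xLeft_eq_kronecker`).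
[cite: KovalevPryadko2013Hyperbicycle, §IV.A eq. (19) (arXiv:1212.6703 chunk p0009 L15-28)] -/
def xLeft (a : ZMod c → Matrix R₁ N₁ (ZMod 2)) :
    Matrix (R₂ × ZMod c × R₁) (R₂ × ZMod c × N₁) (ZMod 2) :=
  Matrix.of fun r q => if r.1 = q.1 then a (q.2.1 - r.2.1) r.2.2 q.2.2 else 0

/-- Right block of `G_X` with the block-shift twist: `Σᵢ bᵢ ⊗ I_{χi} ⊗ E_a`, rows `(β, k, u)`, columns
`(ν, j, u') ∈ N₂ × ℤ_c × R₁`, entry `δ_{uu'} · Σᵢ [j = k + χi] (bᵢ)_{βν} = δ_{uu'} · (b_{χ⁻¹(j−k)})_{βν}`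
(`χ` a unit of `ℤ_c`: "the positive integers `c` and `χ` are coprime"). `χ = 1` is the printed untwisted
block `Σᵢ bᵢ ⊗ Iᵢ ⊗ E_a`. Definition (closed form; `xRight_eq_kronecker`).
[cite: KovalevPryadko2013Hyperbicycle, §IV.A eq. (19) and §IV.F (arXiv:1212.6703 chunk p0009 L15-33, p0015 L45-48)] -/
def xRight (b : ZMod c → Matrix R₂ N₂ (ZMod 2)) (χ : (ZMod c)ˣ) :
    Matrix (R₂ × ZMod c × R₁) (N₂ × ZMod c × R₁) (ZMod 2) :=
  Matrix.of fun r q => if r.2.2 = q.2.2 then b (↑χ⁻¹ * (q.2.1 - r.2.1)) r.1 q.1 else 0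

/-- Left block of `G_Z`: `Σᵢ bᵢᵀ ⊗ I_{χi}ᵀ ⊗ Ẽ_a`, rows `(ν, k', μ) ∈ N₂ × ℤ_c × N₁`, columns
`(β', j, v) ∈ R₂ × ℤ_c × N₁`, entry `δ_{μv} · (b_{χ⁻¹(k'−j)})_{β'ν}`. Definition.
[cite: KovalevPryadko2013Hyperbicycle, §IV.A eq. (19) (arXiv:1212.6703 chunk p0009 L15-33)] -/
def zLeft (b : ZMod c → Matrix R₂ N₂ (ZMod 2)) (χ : (ZMod c)ˣ) :
    Matrix (N₂ × ZMod c × N₁) (R₂ × ZMod c × N₁) (ZMod 2) :=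
  Matrix.of fun r q => if r.2.2 = q.2.2 then b (↑χ⁻¹ * (r.2.1 - q.2.1)) q.1 r.1 else 0

/-- Right block of `G_Z`: `Ẽ_b ⊗ Σᵢ Iᵢᵀ ⊗ aᵢᵀ`, rows `(ν, k', μ)`, columns `(ν', j, u') ∈ N₂ × ℤ_c × R₁`,
entry `δ_{νν'} · (a_{k'−j})_{u'μ}`. Definition.
[cite: KovalevPryadko2013Hyperbicycle, §IV.A eq. (19) (arXiv:1212.6703 chunk p0009 L15-28)] -/
def zRight (a : ZMod c → Matrix R₁ N₁ (ZMod 2)) :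
    Matrix (N₂ × ZMod c × N₁) (N₂ × ZMod c × R₁) (ZMod 2) :=
  Matrix.of fun r q => if r.1 = q.1 then a (r.2.1 - q.2.1) q.2.2 r.2.2 else 0

/-- `G_X = (E_b ⊗ Σᵢ Iᵢ ⊗ aᵢ , Σᵢ bᵢ ⊗ I_{χi} ⊗ E_a)` — the hyperbicycle `X`-check matrix with the block-shift
twist `χ` (unit of `ℤ_c`) on the `b`-block; `c r₁ r₂` rows, `c (r₂n₁ + n₂r₁)` columns. Definition
(computable). [cite: KovalevPryadko2013Hyperbicycle, §IV.A eq. (19) (arXiv:1212.6703 chunk p0009 L15-42)] -/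
def xMatrix (a : ZMod c → Matrix R₁ N₁ (ZMod 2)) (b : ZMod c → Matrix R₂ N₂ (ZMod 2)) (χ : (ZMod c)ˣ) :
    Matrix (R₂ × ZMod c × R₁) ((R₂ × ZMod c × N₁) ⊕ (N₂ × ZMod c × R₁)) (ZMod 2) :=
  Matrix.fromCols (xLeft a) (xRight b χ)

/-- `G_Z = (Σᵢ bᵢᵀ ⊗ I_{χi}ᵀ ⊗ Ẽ_a , Ẽ_b ⊗ Σᵢ Iᵢᵀ ⊗ aᵢᵀ)` — the hyperbicycle `Z`-check matrix; `c n₁ n₂` rows.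
Definition (computable). [cite: KovalevPryadko2013Hyperbicycle, §IV.A eq. (19) (arXiv:1212.6703 chunk p0009 L15-42)] -/
def zMatrix (a : ZMod c → Matrix R₁ N₁ (ZMod 2)) (b : ZMod c → Matrix R₂ N₂ (ZMod 2)) (χ : (ZMod c)ˣ) :
    Matrix (N₂ × ZMod c × N₁) ((R₂ × ZMod c × N₁) ⊕ (N₂ × ZMod c × R₁)) (ZMod 2) :=
  Matrix.fromCols (zLeft b χ) (zRight a)

/-! ### Faithfulness: the closed-form entries are those of the displayed Kronecker sums -/

omit [Fintype R₁] [Fintype N₁] [Fintype R₂] [DecidableEq R₁] [DecidableEq N₁] in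
/-- The left block IS `E_b ⊗ (Σᵢ Iᵢ ⊗ aᵢ)` (Kronecker product over the index triple `(β, (k, u))`).
[cite: KovalevPryadko2013Hyperbicycle, §IV.A eq. (19), (21) (arXiv:1212.6703 chunk p0009 L15-28, L55-58)] -/
theorem xLeft_eq_kronecker (a : ZMod c → Matrix R₁ N₁ (ZMod 2)) :
    (xLeft a : Matrix (R₂ × ZMod c × R₁) (R₂ × ZMod c × N₁) (ZMod 2)) =
      (1 : Matrix R₂ R₂ (ZMod 2)) ⊗ₖ (∑ i : ZMod c, cycPerm i ⊗ₖ a i) := by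
  ext ⟨β, k, u⟩ ⟨β', j, v⟩
  simp only [xLeft, of_apply, kroneckerMap_apply, Matrix.sum_apply, cycPerm_apply, one_apply, ite_mul,
    one_mul, zero_mul]
  by_cases h : β = β'
  · rw [if_pos h, if_pos h, Finset.sum_eq_single (j - k)]
    · rw [if_pos (by abel)]
    · intro i _ hi
      exact if_neg fun h' => hi (by rw [h', add_sub_cancel_left])
    · intro h'
      exact absurd (Finset.mem_univ _) h'
  · rw [if_neg h, if_neg h]

omit [Fintype R₁] [Fintype R₂] [Fintype N₂] [DecidableEq R₂] [DecidableEq N₂] in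
/-- The right block IS `(Σᵢ bᵢ ⊗ I_{χi}) ⊗ E_a` (Kronecker product over the index triple `((β, k), u)`,
re-associated). [cite: KovalevPryadko2013Hyperbicycle, §IV.A eq. (19), (21) (arXiv:1212.6703 chunk p0009 L15-33, L55-58)] -/
theorem xRight_eq_kronecker (b : ZMod c → Matrix R₂ N₂ (ZMod 2)) (χ : (ZMod c)ˣ)
    (β : R₂) (k : ZMod c) (u : R₁) (ν : N₂) (j : ZMod c) (u' : R₁) :
    xRight b χ (β, k, u) (ν, j, u') =
      ((∑ i : ZMod c, b i ⊗ₖ cycPerm ((χ : ZMod c) * i)) ⊗ₖ (1 : Matrix R₁ R₁ (ZMod 2)))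
        ((β, k), u) ((ν, j), u') := by
  simp only [xRight, of_apply, kroneckerMap_apply, Matrix.sum_apply, cycPerm_apply, one_apply, mul_ite,
    mul_one, mul_zero]
  by_cases h : u = u'
  · rw [if_pos h, if_pos h, ← sum_ite_eq_add_mul χ k j (fun i => b i β ν)]
  · rw [if_neg h, if_neg h]

/-! ### The CSS condition -/

omit [Fintype R₁] [Fintype N₂] [DecidableEq R₁] [DecidableEq N₂] in
/-- Entry of the left block product: `(X_L Z_Lᵀ)_{(β,k,u),(ν,k',μ)} = Σⱼ (a_{j−k})_{uμ} (b_{χ⁻¹(k'−j)})_{βν}`.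
[cite: KovalevPryadko2013Hyperbicycle, §IV.A (arXiv:1212.6703 chunk p0009 L45-47)] -/
theorem xLeft_mul_zLeft_transpose_apply (a : ZMod c → Matrix R₁ N₁ (ZMod 2))
    (b : ZMod c → Matrix R₂ N₂ (ZMod 2)) (χ : (ZMod c)ˣ)
    (β : R₂) (k : ZMod c) (u : R₁) (ν : N₂) (k' : ZMod c) (μ : N₁) :
    (xLeft a * (zLeft b χ)ᵀ : Matrix (R₂ × ZMod c × R₁) (N₂ × ZMod c × N₁) (ZMod 2)) (β, k, u) (ν, k', μ) =
      ∑ j : ZMod c, a (j - k) u μ * b (↑χ⁻¹ * (k' - j)) β ν := by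
  simp only [mul_apply, transpose_apply, xLeft, zLeft, of_apply, Fintype.sum_prod_type]
  rw [Finset.sum_eq_single β]
  · simp only [if_true, mul_ite, mul_zero, Finset.sum_ite_eq, Finset.mem_univ, if_true]
  · intro β' _ hβ'
    simp only [if_neg (Ne.symm hβ'), zero_mul, Finset.sum_const_zero]
  · intro h
    exact absurd (Finset.mem_univ _) h

omit [Fintype N₁] [Fintype R₂] [DecidableEq N₁] [DecidableEq R₂] in
/-- Entry of the right block product: `(X_R Z_Rᵀ)_{(β,k,u),(ν,k',μ)} = Σⱼ (b_{χ⁻¹(j−k)})_{βν} (a_{k'−j})_{uμ}`.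
[cite: KovalevPryadko2013Hyperbicycle, §IV.A (arXiv:1212.6703 chunk p0009 L45-47)] -/
theorem xRight_mul_zRight_transpose_apply (a : ZMod c → Matrix R₁ N₁ (ZMod 2))
    (b : ZMod c → Matrix R₂ N₂ (ZMod 2)) (χ : (ZMod c)ˣ)
    (β : R₂) (k : ZMod c) (u : R₁) (ν : N₂) (k' : ZMod c) (μ : N₁) :
    (xRight b χ * (zRight a)ᵀ : Matrix (R₂ × ZMod c × R₁) (N₂ × ZMod c × N₁) (ZMod 2)) (β, k, u) (ν, k', μ) =
      ∑ j : ZMod c, b (↑χ⁻¹ * (j - k)) β ν * a (k' - j) u μ := by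
  simp only [mul_apply, transpose_apply, xRight, zRight, of_apply, Fintype.sum_prod_type]
  rw [Finset.sum_eq_single ν]
  · simp only [if_true, ite_mul, zero_mul, Finset.sum_ite_eq, Finset.mem_univ, if_true]
  · intro ν' _ hν'
    simp only [if_neg (Ne.symm hν'), mul_zero, Finset.sum_const_zero]
  · intro h
    exact absurd (Finset.mem_univ _) h

/-- **The CSS condition `G_X G_Zᵀ = 0`** for the hyperbicycle matrices, for ARBITRARY blocks `aᵢ, bᵢ` and
every twist `χ` coprime to `c` ("The commutativity condition `G_X G_Zᵀ = 0` is obviously satisfied …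
since the permutation matrices commute with each other"): both block products equal
`Σⱼ (a_{j−k})_{uμ} (b_{χ⁻¹(k'−j)})_{βν}` (substitute `j ↦ k + k' − j` in the second) and cancel in
characteristic `2`. Proved. [cite: KovalevPryadko2013Hyperbicycle, §IV.A (arXiv:1212.6703 chunk p0009 L45-47)] -/
theorem xMatrix_mul_zMatrix_transpose (a : ZMod c → Matrix R₁ N₁ (ZMod 2))
    (b : ZMod c → Matrix R₂ N₂ (ZMod 2)) (χ : (ZMod c)ˣ) :
    xMatrix a b χ * (zMatrix a b χ)ᵀ = 0 := by
  rw [xMatrix, zMatrix, transpose_fromCols, fromCols_mul_fromRows]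
  ext ⟨β, k, u⟩ ⟨ν, k', μ⟩
  rw [Matrix.add_apply, Matrix.zero_apply, xLeft_mul_zLeft_transpose_apply,
    xRight_mul_zRight_transpose_apply]
  have hre : (∑ j : ZMod c, b (↑χ⁻¹ * (j - k)) β ν * a (k' - j) u μ) =
      ∑ j : ZMod c, a (j - k) u μ * b (↑χ⁻¹ * (k' - j)) β ν := by
    refine Fintype.sum_equiv (Equiv.subLeft (k + k')) _ _ fun j => ?_
    rw [Equiv.subLeft_apply, mul_comm,
      show k + k' - j - k = k' - j by abel, show k' - (k + k' - j) = j - k by abel]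
  rw [hre]
  generalize (∑ j : ZMod c, a (j - k) u μ * b (↑χ⁻¹ * (k' - j)) β ν) = x
  revert x
  decide

/-- **The hyperbicycle CSS code** `(G_X, G_Z)` of eq. (19) with twist `χ` (unit of `ℤ_c`) on the `b`-block,
as a `CSSCode` (commutation proved). Definition.
[cite: KovalevPryadko2013Hyperbicycle, §IV.A eq. (19) (arXiv:1212.6703 chunk p0009 L15-47)] -/
def code (a : ZMod c → Matrix R₁ N₁ (ZMod 2)) (b : ZMod c → Matrix R₂ N₂ (ZMod 2)) (χ : (ZMod c)ˣ) :
    CSSCode (R₂ × ZMod c × R₁) (N₂ × ZMod c × N₁) ((R₂ × ZMod c × N₁) ⊕ (N₂ × ZMod c × R₁)) where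
  HX := xMatrix a b χ
  HZ := zMatrix a b χ
  comm := xMatrix_mul_zMatrix_transpose a b χ

omit [DecidableEq R₁] [DecidableEq N₁] [DecidableEq R₂] [DecidableEq N₂] in
/-- **Block length** `N = c (r₂ n₁ + n₂ r₁)` ("they both have `N ≡ c(r₁n₂ + r₂n₁)` columns, which gives
the block length of the quantum code"). Proved.
[cite: KovalevPryadko2013Hyperbicycle, §IV.A eq. (20) (arXiv:1212.6703 chunk p0009 L37-42)] -/
theorem card_qubits :
    Fintype.card ((R₂ × ZMod c × N₁) ⊕ (N₂ × ZMod c × R₁)) =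
      c * (Fintype.card R₂ * Fintype.card N₁ + Fintype.card N₂ * Fintype.card R₁) := by
  simp only [Fintype.card_sum, Fintype.card_prod, ZMod.card]
  ring

omit [DecidableEq R₁] [DecidableEq N₁] [DecidableEq R₂] [DecidableEq N₂] in
/-- Numbers of rows: `G_X` has `c r₁ r₂` rows and `G_Z` has `c n₁ n₂` rows ("not all of the rows are
linearly independent"). Proved.
[cite: KovalevPryadko2013Hyperbicycle, §IV.A (arXiv:1212.6703 chunk p0009 L37-39)] -/
theorem card_checks :
    Fintype.card (R₂ × ZMod c × R₁) = c * (Fintype.card R₁ * Fintype.card R₂) ∧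
      Fintype.card (N₂ × ZMod c × N₁) = c * (Fintype.card N₁ * Fintype.card N₂) := by
  simp only [Fintype.card_prod, ZMod.card]
  constructor <;> ring

/-! ### The literal two-sided reading `Iᵢ^(χ) = S_χ Iᵢ` in both blocks, and its `χ`-triviality -/

/-- Left block of `G_X` in the LITERAL reading: `E_b ⊗ Σᵢ (S_χ Iᵢ) ⊗ aᵢ`, entry `δ_{ββ'} (a_{j−χk})_{uv}`
(block row `k` of `𝓗₁` is `(a_{1−χk}, a_{2−χk}, …)`: "subsequent block rows are shifted by `χ` positions",
the printed `c = 5, χ = 2` example). Definition.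
[cite: KovalevPryadko2013Hyperbicycle, §IV.A eq. (19), (21)-(23) (arXiv:1212.6703 chunk p0009 L15-33, L62-72, L85-90)] -/
def litXLeft (a : ZMod c → Matrix R₁ N₁ (ZMod 2)) (χ : ZMod c) :
    Matrix (R₂ × ZMod c × R₁) (R₂ × ZMod c × N₁) (ZMod 2) :=
  Matrix.of fun r q => if r.1 = q.1 then a (q.2.1 - χ * r.2.1) r.2.2 q.2.2 else 0

/-- Right block of `G_X` in the LITERAL reading: `Σᵢ bᵢ ⊗ (S_χ Iᵢ) ⊗ E_a`, entry `δ_{uu'} (b_{j−χk})_{βν}`.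
Definition. [cite: KovalevPryadko2013Hyperbicycle, §IV.A eq. (19), (23) (arXiv:1212.6703 chunk p0009 L15-33, L85-90)] -/
def litXRight (b : ZMod c → Matrix R₂ N₂ (ZMod 2)) (χ : ZMod c) :
    Matrix (R₂ × ZMod c × R₁) (N₂ × ZMod c × R₁) (ZMod 2) :=
  Matrix.of fun r q => if r.2.2 = q.2.2 then b (q.2.1 - χ * r.2.1) r.1 q.1 else 0

/-- Left block of `G_Z` in the LITERAL reading: `Σᵢ bᵢᵀ ⊗ (S_χᵀ Iᵢᵀ) ⊗ Ẽ_a`; since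
`(S_χᵀ Iᵢᵀ)_{k'j} = δ_{k', χ(j+i)}`, the entry is `δ_{μv} (b_{χ⁻¹k'−j})_{β'ν}` (`χ` coprime to `c`).
Definition. [cite: KovalevPryadko2013Hyperbicycle, §IV.A eq. (19), (23) (arXiv:1212.6703 chunk p0009 L15-33, L85-90)] -/
def litZLeft (b : ZMod c → Matrix R₂ N₂ (ZMod 2)) (χ : (ZMod c)ˣ) :
    Matrix (N₂ × ZMod c × N₁) (R₂ × ZMod c × N₁) (ZMod 2) :=
  Matrix.of fun r q => if r.2.2 = q.2.2 then b (↑χ⁻¹ * r.2.1 - q.2.1) q.1 r.1 else 0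

/-- Right block of `G_Z` in the LITERAL reading: `Ẽ_b ⊗ Σᵢ (S_χᵀ Iᵢᵀ) ⊗ aᵢᵀ`, entry `δ_{νν'} (a_{χ⁻¹k'−j})_{u'μ}`.
Definition (`litZRight_eq_kronecker`).
[cite: KovalevPryadko2013Hyperbicycle, §IV.A eq. (19), (23) (arXiv:1212.6703 chunk p0009 L15-33, L85-90)] -/
def litZRight (a : ZMod c → Matrix R₁ N₁ (ZMod 2)) (χ : (ZMod c)ˣ) :
    Matrix (N₂ × ZMod c × N₁) (N₂ × ZMod c × R₁) (ZMod 2) :=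
  Matrix.of fun r q => if r.1 = q.1 then a (↑χ⁻¹ * r.2.1 - q.2.1) q.2.2 r.2.2 else 0

omit [Fintype R₁] [Fintype N₁] [Fintype R₂] [DecidableEq R₁] [DecidableEq N₁] in
/-- FAITHFULNESS of the literal reading: its left `X`-block IS `E_b ⊗ Σᵢ (S_χ Iᵢ) ⊗ aᵢ` with the printed
`S_χ` and `Iᵢ`. [cite: KovalevPryadko2013Hyperbicycle, §IV.A eq. (19) (arXiv:1212.6703 chunk p0009 L15-33)] -/
theorem litXLeft_eq_kronecker (a : ZMod c → Matrix R₁ N₁ (ZMod 2)) (χ : ZMod c) :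
    (litXLeft a χ : Matrix (R₂ × ZMod c × R₁) (R₂ × ZMod c × N₁) (ZMod 2)) =
      (1 : Matrix R₂ R₂ (ZMod 2)) ⊗ₖ (∑ i : ZMod c, (mulPerm χ * cycPerm i) ⊗ₖ a i) := by
  ext ⟨β, k, u⟩ ⟨β', j, v⟩
  simp only [litXLeft, of_apply, kroneckerMap_apply, Matrix.sum_apply, mulPerm_mul_cycPerm_apply,
    one_apply, ite_mul, one_mul, zero_mul]
  by_cases h : β = β'
  · rw [if_pos h, if_pos h, Finset.sum_eq_single (j - χ * k)]
    · rw [if_pos (by abel)]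
    · intro i _ hi
      exact if_neg fun h' => hi (by rw [h', add_sub_cancel_left])
    · intro h'
      exact absurd (Finset.mem_univ _) h'
  · rw [if_neg h, if_neg h]

omit [Fintype R₁] [Fintype R₂] [Fintype N₂] [DecidableEq R₂] [DecidableEq N₂] in
/-- FAITHFULNESS of the literal reading, right `X`-block: it IS `(Σᵢ bᵢ ⊗ (S_χ Iᵢ)) ⊗ E_a` (re-associated).
[cite: KovalevPryadko2013Hyperbicycle, §IV.A eq. (19) (arXiv:1212.6703 chunk p0009 L15-33)] -/
theorem litXRight_eq_kronecker (b : ZMod c → Matrix R₂ N₂ (ZMod 2)) (χ : ZMod c)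
    (β : R₂) (k : ZMod c) (u : R₁) (ν : N₂) (j : ZMod c) (u' : R₁) :
    litXRight b χ (β, k, u) (ν, j, u') =
      ((∑ i : ZMod c, b i ⊗ₖ (mulPerm χ * cycPerm i)) ⊗ₖ (1 : Matrix R₁ R₁ (ZMod 2)))
        ((β, k), u) ((ν, j), u') := by
  simp only [litXRight, of_apply, kroneckerMap_apply, Matrix.sum_apply, mulPerm_mul_cycPerm_apply,
    one_apply, mul_ite, mul_one, mul_zero]
  by_cases h : u = u'
  · rw [if_pos h, if_pos h, Finset.sum_eq_single (j - χ * k)]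
    · rw [if_pos (by abel)]
    · intro i _ hi
      exact if_neg fun h' => hi (by rw [h', add_sub_cancel_left])
    · intro h'
      exact absurd (Finset.mem_univ _) h'
  · rw [if_neg h, if_neg h]

omit [Fintype R₁] [Fintype N₁] [Fintype N₂] [DecidableEq R₁] [DecidableEq N₁] in
/-- FAITHFULNESS of the literal reading, right `Z`-block: it IS `Ẽ_b ⊗ Σᵢ (S_χᵀ Iᵢᵀ) ⊗ aᵢᵀ` with the
printed `S_χ`, `Iᵢ`. [cite: KovalevPryadko2013Hyperbicycle, §IV.A eq. (19) (arXiv:1212.6703 chunk p0009 L15-33)] -/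
theorem litZRight_eq_kronecker (a : ZMod c → Matrix R₁ N₁ (ZMod 2)) (χ : (ZMod c)ˣ) :
    (litZRight a χ : Matrix (N₂ × ZMod c × N₁) (N₂ × ZMod c × R₁) (ZMod 2)) =
      (1 : Matrix N₂ N₂ (ZMod 2)) ⊗ₖ
        (∑ i : ZMod c, ((mulPerm (χ : ZMod c))ᵀ * (cycPerm i)ᵀ) ⊗ₖ (a i)ᵀ) := by
  ext ⟨ν, k', μ⟩ ⟨ν', j, u'⟩
  simp only [litZRight, of_apply, kroneckerMap_apply, Matrix.sum_apply,
    transpose_mulPerm_mul_transpose_cycPerm_apply, transpose_apply, one_apply, ite_mul, one_mul, zero_mul]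
  by_cases h : ν = ν'
  · rw [if_pos h, if_pos h, Finset.sum_eq_single (↑χ⁻¹ * k' - j)]
    · rw [if_pos (by rw [add_sub_cancel, Units.mul_inv_cancel_left])]
    · intro i _ hi
      exact if_neg fun h' => hi (by rw [h', Units.inv_mul_cancel_left, add_sub_cancel_left])
    · intro h'
      exact absurd (Finset.mem_univ _) h'
  · rw [if_neg h, if_neg h]

/-- The literal `G_X = (E_b ⊗ Σᵢ S_χIᵢ ⊗ aᵢ , Σᵢ bᵢ ⊗ S_χIᵢ ⊗ E_a)`. Definition.
[cite: KovalevPryadko2013Hyperbicycle, §IV.A eq. (19), (23) (arXiv:1212.6703 chunk p0009 L15-33, L85-90)] -/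
def litXMatrix (a : ZMod c → Matrix R₁ N₁ (ZMod 2)) (b : ZMod c → Matrix R₂ N₂ (ZMod 2)) (χ : ZMod c) :
    Matrix (R₂ × ZMod c × R₁) ((R₂ × ZMod c × N₁) ⊕ (N₂ × ZMod c × R₁)) (ZMod 2) :=
  Matrix.fromCols (litXLeft a χ) (litXRight b χ)

/-- The literal `G_Z = (Σᵢ bᵢᵀ ⊗ S_χᵀIᵢᵀ ⊗ Ẽ_a , Ẽ_b ⊗ Σᵢ S_χᵀIᵢᵀ ⊗ aᵢᵀ)`. Definition.
[cite: KovalevPryadko2013Hyperbicycle, §IV.A eq. (19), (23) (arXiv:1212.6703 chunk p0009 L15-33, L85-90)] -/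
def litZMatrix (a : ZMod c → Matrix R₁ N₁ (ZMod 2)) (b : ZMod c → Matrix R₂ N₂ (ZMod 2))
    (χ : (ZMod c)ˣ) :
    Matrix (N₂ × ZMod c × N₁) ((R₂ × ZMod c × N₁) ⊕ (N₂ × ZMod c × R₁)) (ZMod 2) :=
  Matrix.fromCols (litZLeft b χ) (litZRight a χ)

/-- The row relabelling `(β, k, u) ↦ (β, χk, u)` of the `X`-checks (a bijection since `gcd(c, χ) = 1`):
the permutation `E ⊗ S_χ ⊗ E` of eq. (23). Definition.
[cite: KovalevPryadko2013Hyperbicycle, §IV.A eq. (23) (arXiv:1212.6703 chunk p0009 L85-90)] -/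
def rowTwist (χ : (ZMod c)ˣ) (T : Type*) (S : Type*) : T × ZMod c × S ≃ T × ZMod c × S :=
  Equiv.prodCongr (Equiv.refl T) (Equiv.prodCongr χ.mulLeft (Equiv.refl S))

omit [NeZero c] in
/-- `rowTwist χ (β, k, u) = (β, χk, u)`. [cite: KovalevPryadko2013Hyperbicycle, §IV.A eq. (23) (arXiv:1212.6703 chunk p0009 L85-90)] -/
@[simp] theorem rowTwist_apply (χ : (ZMod c)ˣ) {T S : Type*} (β : T) (k : ZMod c) (u : S) :
    rowTwist χ T S (β, k, u) = (β, (χ : ZMod c) * k, u) := rfl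

omit [NeZero c] [Fintype R₁] [Fintype N₁] [Fintype R₂] [Fintype N₂] [DecidableEq N₁] [DecidableEq N₂] in
/-- **Eq. (23), `X` side**: the literal `G_X^(χ)` is the untwisted `G_X^(1)` with its ROWS permuted by
`(β,k,u) ↦ (β,χk,u)` — `G_X^(χ) = (E ⊗ S_χ ⊗ E) G_X^(1)`. Proved.
[cite: KovalevPryadko2013Hyperbicycle, §IV.A eq. (23) (arXiv:1212.6703 chunk p0009 L85-90)] -/
theorem litXMatrix_eq_submatrix (a : ZMod c → Matrix R₁ N₁ (ZMod 2)) (b : ZMod c → Matrix R₂ N₂ (ZMod 2))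
    (χ : (ZMod c)ˣ) :
    litXMatrix a b χ = (xMatrix a b 1).submatrix (rowTwist χ R₂ R₁) (Equiv.refl _) := by
  ext ⟨β, k, u⟩ q
  rcases q with ⟨β', j, v⟩ | ⟨ν, j, u'⟩
  · simp [litXMatrix, xMatrix, litXLeft, xLeft]
  · simp [litXMatrix, xMatrix, litXRight, xRight]

omit [NeZero c] [Fintype R₁] [Fintype N₁] [Fintype R₂] [Fintype N₂] [DecidableEq R₁] [DecidableEq R₂] in
/-- **Eq. (23), `Z` side**: the literal `G_Z^(χ)` is the untwisted `G_Z^(1)` with its rows permuted by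
`(ν,k',μ) ↦ (ν,χ⁻¹k',μ)` — `G_Z^(χ) = (E ⊗ S_χᵀ ⊗ E) G_Z^(1)` (row `k'` of `S_χᵀ M` is row `χ⁻¹k'` of `M`).
Proved. [cite: KovalevPryadko2013Hyperbicycle, §IV.A eq. (23) (arXiv:1212.6703 chunk p0009 L85-90)] -/
theorem litZMatrix_eq_submatrix (a : ZMod c → Matrix R₁ N₁ (ZMod 2)) (b : ZMod c → Matrix R₂ N₂ (ZMod 2))
    (χ : (ZMod c)ˣ) :
    litZMatrix a b χ = (zMatrix a b 1).submatrix (rowTwist χ⁻¹ N₂ N₁) (Equiv.refl _) := by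
  ext ⟨ν, k', μ⟩ q
  rcases q with ⟨β', j, v⟩ | ⟨ν', j, u'⟩
  · simp [litZMatrix, zMatrix, litZLeft, zLeft]
  · simp [litZMatrix, zMatrix, litZRight, zRight]

/-- The literal matrices also satisfy the CSS condition (they are row permutations of `(G_X^(1), G_Z^(1))`).
Proved. [cite: KovalevPryadko2013Hyperbicycle, §IV.A (arXiv:1212.6703 chunk p0009 L45-47)] -/
theorem litXMatrix_mul_litZMatrix_transpose (a : ZMod c → Matrix R₁ N₁ (ZMod 2))
    (b : ZMod c → Matrix R₂ N₂ (ZMod 2)) (χ : (ZMod c)ˣ) :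
    litXMatrix a b χ * (litZMatrix a b χ)ᵀ = 0 := by
  rw [litXMatrix_eq_submatrix, litZMatrix_eq_submatrix, transpose_submatrix, submatrix_mul_equiv,
    xMatrix_mul_zMatrix_transpose, submatrix_zero]
  rfl

/-- **The hyperbicycle code in the LITERAL two-sided reading** of eq. (19) (`Iᵢ^(χ) = S_χ Iᵢ` in both blocks),
`χ` coprime to `c`. Definition. [cite: KovalevPryadko2013Hyperbicycle, §IV.A eq. (19), (23) (arXiv:1212.6703 chunk p0009 L15-33, L85-90)] -/
def litCode (a : ZMod c → Matrix R₁ N₁ (ZMod 2)) (b : ZMod c → Matrix R₂ N₂ (ZMod 2)) (χ : (ZMod c)ˣ) :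
    CSSCode (R₂ × ZMod c × R₁) (N₂ × ZMod c × N₁) ((R₂ × ZMod c × N₁) ⊕ (N₂ × ZMod c × R₁)) where
  HX := litXMatrix a b χ
  HZ := litZMatrix a b χ
  comm := litXMatrix_mul_litZMatrix_transpose a b χ

/-- **`χ`-TRIVIALITY of the printed formula.** The literal two-sided hyperbicycle code with ANY twist `χ`
coprime to `c` is the re-indexed (`X`-rows by `E ⊗ S_χ ⊗ E`, `Z`-rows by `E ⊗ S_χᵀ ⊗ E`, qubits fixed)
untwisted code `χ = 1`. Proved — a theorem ABOUT the printed eq. (19)+(23) (consistent with the paper's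
"the parameter `χ` … corresponds to permutations of rows", p0010 L98-100), recorded because §IV.F–G use
`χ` to change parameters, which this object cannot do.
[cite: KovalevPryadko2013Hyperbicycle, §IV.A eq. (23) and §IV.B proof of Lemma 2 (arXiv:1212.6703 chunk p0009 L85-90, p0010 L98-100)] -/
theorem litCode_eq_reindex (a : ZMod c → Matrix R₁ N₁ (ZMod 2)) (b : ZMod c → Matrix R₂ N₂ (ZMod 2))
    (χ : (ZMod c)ˣ) :
    litCode a b χ = (code a b 1).reindex (rowTwist χ R₂ R₁).symm (rowTwist χ⁻¹ N₂ N₁).symm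
      (Equiv.refl _).symm :=
  CSSCode.eq_reindex_of_submatrix (C := code a b 1) (C' := litCode a b χ)
    (litXMatrix_eq_submatrix a b χ) (litZMatrix_eq_submatrix a b χ)

/-- `χ`-triviality, parameters: the literal code is `[[n, k, d]]` iff the untwisted (`χ = 1`) code is.
Proved. [cite: KovalevPryadko2013Hyperbicycle, §IV.A eq. (23) (arXiv:1212.6703 chunk p0009 L85-90)] -/
theorem litCode_isCode_iff (a : ZMod c → Matrix R₁ N₁ (ZMod 2)) (b : ZMod c → Matrix R₂ N₂ (ZMod 2))
    (χ : (ZMod c)ˣ) (n k d : ℕ) :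
    (litCode a b χ).IsCode n k d ↔ (code a b 1).IsCode n k d :=
  CSSCode.isCode_iff_of_submatrix (C := code a b 1) (C' := litCode a b χ)
    (litXMatrix_eq_submatrix a b χ) (litZMatrix_eq_submatrix a b χ) n k d

/-- `χ`-triviality, `X`-distance: `d^X(literal, χ) = d^X(χ = 1)`. Proved.
[cite: KovalevPryadko2013Hyperbicycle, §IV.A eq. (23) (arXiv:1212.6703 chunk p0009 L85-90)] -/
theorem litCode_dX (a : ZMod c → Matrix R₁ N₁ (ZMod 2)) (b : ZMod c → Matrix R₂ N₂ (ZMod 2))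
    (χ : (ZMod c)ˣ) : (litCode a b χ).dX = (code a b 1).dX :=
  CSSCode.dX_eq_of_submatrix (C := code a b 1) (C' := litCode a b χ)
    (litXMatrix_eq_submatrix a b χ) (litZMatrix_eq_submatrix a b χ)

/-- `χ`-triviality, `Z`-distance: `d^Z(literal, χ) = d^Z(χ = 1)`. Proved.
[cite: KovalevPryadko2013Hyperbicycle, §IV.A eq. (23) (arXiv:1212.6703 chunk p0009 L85-90)] -/
theorem litCode_dZ (a : ZMod c → Matrix R₁ N₁ (ZMod 2)) (b : ZMod c → Matrix R₂ N₂ (ZMod 2))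
    (χ : (ZMod c)ˣ) : (litCode a b χ).dZ = (code a b 1).dZ :=
  CSSCode.dZ_eq_of_submatrix (C := code a b 1) (C' := litCode a b χ)
    (litXMatrix_eq_submatrix a b χ) (litZMatrix_eq_submatrix a b χ)

/-- `χ`-triviality, dimension: `k(literal, χ) = k(χ = 1)`. Proved.
[cite: KovalevPryadko2013Hyperbicycle, §IV.A eq. (23) (arXiv:1212.6703 chunk p0009 L85-90)] -/
theorem litCode_k (a : ZMod c → Matrix R₁ N₁ (ZMod 2)) (b : ZMod c → Matrix R₂ N₂ (ZMod 2))
    (χ : (ZMod c)ˣ) : (litCode a b χ).k = (code a b 1).k :=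
  CSSCode.k_eq_of_submatrix (C := code a b 1) (C' := litCode a b χ)
    (litXMatrix_eq_submatrix a b χ) (litZMatrix_eq_submatrix a b χ)

end Hyperbicycle

/-! ### The "two circulant matrices" family of §IV.G (the census `HB` objects) -/

namespace Hyperbicycle

/-- The `n × n` blocks `aᵢ` (`i ∈ ℤ_c`) of the `cn × cn` binary circulant of `h : ℤ_{cn} → 𝔽₂`
(`B(h)_{pq} = h_{p−q}`, the circulant-matrix convention of `AbelianTwoBlockCodes` / the qec kernels):
`(aᵢ)_{uv} = B(h)_{u, in+v} = h_{u − in − v}`, so that `B(h) = Σᵢ Iᵢ ⊗ aᵢ` ("any circulant matrix will have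
the block form of Eq. (21)"). Definition.
[cite: KovalevPryadko2013Hyperbicycle, §IV.G (arXiv:1212.6703 chunk p0015 L62-70)] -/
def squareBlocks (c n : ℕ) (h : ZMod (c * n) → ZMod 2) (i : ZMod c) : Matrix (Fin n) (Fin n) (ZMod 2) :=
  Matrix.of fun u v => h (((u : ℕ) : ZMod (c * n)) - ((i.val * n + (v : ℕ) : ℕ) : ZMod (c * n)))

/-- **The square ("two circulant matrices") hyperbicycle code** of §IV.G: `aᵢ = bᵢ =` the blocks of the
`cn × cn` circulant of `h`, `r₁ = n₁ = r₂ = n₂ = n`, twist `χ` coprime to `c` on one block; `N = 2cn²`.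
The paper's Example 7 (rotated toric codes, `h = 1 + x`, `c = t² + (t+1)²`, `χ = 2t + 1`, printed
`[[2n²c, 2, nχ]]`), Ex. 8 (`[[90,8,8]]`: `h ↔` the cyclic `[15,4,8]` code, `c = 5, χ = 3`), …, Ex. 12
(`[[120,32,4]]`, `c = 15, χ = 2`) are instances [chunk p0016 L18-53]; their parameters are printed CLAIMS
("numerically"), certified or not in `Summits/Ventures/QEC/Census/HB/`, and are NOT asserted here.
Definition. [cite: KovalevPryadko2013Hyperbicycle, §IV.G Examples 7-12 (arXiv:1212.6703 chunk p0015 L62-70, p0016 L18-53)] -/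
def squareCode {c : ℕ} [NeZero c] (n : ℕ) (h : ZMod (c * n) → ZMod 2) (χ : (ZMod c)ˣ) :
    CSSCode (Fin n × ZMod c × Fin n) (Fin n × ZMod c × Fin n)
      ((Fin n × ZMod c × Fin n) ⊕ (Fin n × ZMod c × Fin n)) :=
  code (squareBlocks c n h) (squareBlocks c n h) χ

/-- Block length of the square family: `N = 2 c n²` (Ex. 7: "`[[2n²c, 2, nχ]]`"). Proved.
[cite: KovalevPryadko2013Hyperbicycle, §IV.G Example 7 (arXiv:1212.6703 chunk p0016 L18-22)] -/
theorem card_qubits_square (c n : ℕ) [NeZero c] :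
    Fintype.card ((Fin n × ZMod c × Fin n) ⊕ (Fin n × ZMod c × Fin n)) = 2 * c * n ^ 2 := by
  simp only [Fintype.card_sum, Fintype.card_prod, ZMod.card, Fintype.card_fin]
  ring

end Hyperbicycle


/-! ### `c = 1`: the hypergraph product is recovered (appended 2026-08-27, qec-lit-3 g3) -/

namespace Hyperbicycle

open Matrix

section COne

variable {R₁ N₁ R₂ N₂ : Type*}
variable [Fintype R₁] [Fintype N₁] [Fintype R₂] [Fintype N₂]
variable [DecidableEq R₁] [DecidableEq N₁] [DecidableEq R₂] [DecidableEq N₂]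

/-- Row relabelling for `c = 1`: drop the trivial block index, `(β, 0, u) ↦ (β, u)`. Definition.
[cite: KovalevPryadko2013Hyperbicycle, §IV.A (arXiv:1212.6703 chunk p0009 L47-48: "for c=1 and χ=1 we recover the hypergraph-product codes")] -/
def rowsOne (T S : Type*) : T × ZMod 1 × S ≃ T × S :=
  Equiv.prodCongr (Equiv.refl T) (Equiv.uniqueProd S (ZMod 1))

/-- Column (qubit) relabelling for `c = 1`: our left block `(β, 0, v)` is Tillich–Zémor's `V₁ × E₂` block `(β, v)` and our
right block `(ν, 0, u)` is their `E₁ × V₂` block `(ν, u)` (the tree's `HypergraphProduct.xMatrix H₁ H₂` lists the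
`E₁ × V₂` block first, KP13's eq. (19) lists the `E_b ⊗ 𝓗₁` block first — the same matrix with the two column blocks
exchanged). Definition. [cite: KovalevPryadko2013Hyperbicycle, §IV.A (arXiv:1212.6703 chunk p0009 L47-48)] -/
def colsOne (R₁ N₁ R₂ N₂ : Type*) : (R₂ × ZMod 1 × N₁) ⊕ (N₂ × ZMod 1 × R₁) ≃ (N₂ × R₁) ⊕ (R₂ × N₁) :=
  (Equiv.sumCongr (rowsOne R₂ N₁) (rowsOne N₂ R₁)).trans (Equiv.sumComm _ _)

omit [Fintype R₁] [Fintype N₁] [Fintype R₂] [Fintype N₂] [DecidableEq N₁] [DecidableEq N₂] in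
/-- **`c = 1` recovers the hypergraph product, `X` side**: `G_X = (E_b ⊗ a₀ , b₀ ⊗ E_a)` is the Tillich–Zémor /
Kovalev–Pryadko eq. (7) matrix `[H₁ ⊗ 1 | 1 ⊗ H₂]` with `H₁ = b₀`, `H₂ = a₀`, along the relabellings `rowsOne`, `colsOne`
(any `χ`: `(ℤ_1)ˣ` is trivial). Proved. [cite: KovalevPryadko2013Hyperbicycle, §IV.A (arXiv:1212.6703 chunk p0009 L47-48)] -/
theorem xMatrix_eq_hypergraphProduct_submatrix (a : ZMod 1 → Matrix R₁ N₁ (ZMod 2))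
    (b : ZMod 1 → Matrix R₂ N₂ (ZMod 2)) (χ : (ZMod 1)ˣ) :
    xMatrix a b χ =
      (HypergraphProduct.xMatrix (b 0) (a 0)).submatrix (rowsOne R₂ R₁) (colsOne R₁ N₁ R₂ N₂) := by
  ext ⟨β, k, u⟩ q
  obtain rfl : k = 0 := Subsingleton.elim _ _
  rcases q with ⟨β', j, v⟩ | ⟨ν, j, u'⟩
  · obtain rfl : j = 0 := Subsingleton.elim _ _
    simp only [xMatrix, fromCols_apply_inl, xLeft, of_apply, sub_self, submatrix_apply, rowsOne, colsOne,
      Equiv.prodCongr_apply, Equiv.coe_refl, Prod.map_apply, id_eq, Equiv.uniqueProd_apply, Equiv.trans_apply,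
      Equiv.sumCongr_apply, Sum.map_inl, Equiv.sumComm_apply, Sum.swap_inl, HypergraphProduct.xMatrix_apply_inr]
    split_ifs <;> simp
  · obtain rfl : j = 0 := Subsingleton.elim _ _
    simp only [xMatrix, fromCols_apply_inr, xRight, of_apply, sub_self, mul_zero, submatrix_apply, rowsOne, colsOne,
      Equiv.prodCongr_apply, Equiv.coe_refl, Prod.map_apply, id_eq, Equiv.uniqueProd_apply, Equiv.trans_apply,
      Equiv.sumCongr_apply, Sum.map_inr, Equiv.sumComm_apply, Sum.swap_inr, HypergraphProduct.xMatrix_apply_inl]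
    split_ifs <;> simp

omit [Fintype R₁] [Fintype N₁] [Fintype R₂] [Fintype N₂] [DecidableEq R₁] [DecidableEq R₂] in
/-- **`c = 1` recovers the hypergraph product, `Z` side**: `G_Z = (b₀ᵀ ⊗ Ẽ_a , Ẽ_b ⊗ a₀ᵀ)` is `[1 ⊗ H₂ᵀ | H₁ᵀ ⊗ 1]` with
`H₁ = b₀`, `H₂ = a₀`, along `rowsOne`, `colsOne`. Proved.
[cite: KovalevPryadko2013Hyperbicycle, §IV.A (arXiv:1212.6703 chunk p0009 L47-48)] -/
theorem zMatrix_eq_hypergraphProduct_submatrix (a : ZMod 1 → Matrix R₁ N₁ (ZMod 2))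
    (b : ZMod 1 → Matrix R₂ N₂ (ZMod 2)) (χ : (ZMod 1)ˣ) :
    zMatrix a b χ =
      (HypergraphProduct.zMatrix (b 0) (a 0)).submatrix (rowsOne N₂ N₁) (colsOne R₁ N₁ R₂ N₂) := by
  ext ⟨ν, k', μ⟩ q
  obtain rfl : k' = 0 := Subsingleton.elim _ _
  rcases q with ⟨β', j, v⟩ | ⟨ν', j, u'⟩
  · obtain rfl : j = 0 := Subsingleton.elim _ _
    simp only [zMatrix, fromCols_apply_inl, zLeft, of_apply, sub_self, mul_zero, submatrix_apply, rowsOne, colsOne,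
      Equiv.prodCongr_apply, Equiv.coe_refl, Prod.map_apply, id_eq, Equiv.uniqueProd_apply, Equiv.trans_apply,
      Equiv.sumCongr_apply, Sum.map_inl, Equiv.sumComm_apply, Sum.swap_inl, HypergraphProduct.zMatrix_apply_inr]
    split_ifs <;> simp
  · obtain rfl : j = 0 := Subsingleton.elim _ _
    simp only [zMatrix, fromCols_apply_inr, zRight, of_apply, sub_self, submatrix_apply, rowsOne, colsOne,
      Equiv.prodCongr_apply, Equiv.coe_refl, Prod.map_apply, id_eq, Equiv.uniqueProd_apply, Equiv.trans_apply,
      Equiv.sumCongr_apply, Sum.map_inr, Equiv.sumComm_apply, Sum.swap_inr, HypergraphProduct.zMatrix_apply_inl]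
    split_ifs <;> simp

/-- The hypergraph-product code `Q_ℋ` of `H₁`, `H₂` (Tillich–Zémor; the tree's `HypergraphProduct.xMatrix/zMatrix`, TZ
Prop. 3 for the commutation) as a `CSSCode`. Definition (a packaging used only to state the `c = 1` comparison).
[cite: TillichZemor2014, Prop. 3 (arXiv v1 chunk p0007 L44-48)] -/
def hgpCode {V₁ E₁ V₂ E₂ : Type*} [Fintype V₁] [Fintype E₁] [Fintype V₂] [Fintype E₂]
    [DecidableEq V₁] [DecidableEq E₁] [DecidableEq V₂] [DecidableEq E₂]
    (H₁ : Matrix V₁ E₁ (ZMod 2)) (H₂ : Matrix V₂ E₂ (ZMod 2)) : CSSCode (V₁ × V₂) (E₁ × E₂) ((E₁ × V₂) ⊕ (V₁ × E₂)) :=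
  CSSCode.ofMatrices (HypergraphProduct.xMatrix H₁ H₂) (HypergraphProduct.zMatrix H₁ H₂)
    (HypergraphProduct.xMatrix_mul_zMatrix_transpose H₁ H₂)

/-- **`c = 1`: the hyperbicycle code IS the hypergraph product** `Q_ℋ(b₀, a₀)` up to the relabellings (so it has the same
`[[n, k, d]]`, `d^X`, `d^Z`, `k` — `CSSCode.isCode_iff_of_submatrix` etc. apply to this identity). Proved.
[cite: KovalevPryadko2013Hyperbicycle, §IV.A (arXiv:1212.6703 chunk p0009 L47-48)] -/
theorem code_eq_hgpCode_reindex (a : ZMod 1 → Matrix R₁ N₁ (ZMod 2)) (b : ZMod 1 → Matrix R₂ N₂ (ZMod 2))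
    (χ : (ZMod 1)ˣ) :
    code a b χ = (hgpCode (b 0) (a 0)).reindex (rowsOne R₂ R₁).symm (rowsOne N₂ N₁).symm
      (colsOne R₁ N₁ R₂ N₂).symm :=
  CSSCode.eq_reindex_of_submatrix (C := hgpCode (b 0) (a 0)) (C' := code a b χ)
    (xMatrix_eq_hypergraphProduct_submatrix a b χ) (zMatrix_eq_hypergraphProduct_submatrix a b χ)

/-- `c = 1`, parameters: the hyperbicycle code is `[[n,k,d]]` iff the hypergraph product `Q_ℋ(b₀, a₀)` is. Proved.
[cite: KovalevPryadko2013Hyperbicycle, §IV.A (arXiv:1212.6703 chunk p0009 L47-48)] -/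
theorem code_isCode_iff_hgpCode (a : ZMod 1 → Matrix R₁ N₁ (ZMod 2)) (b : ZMod 1 → Matrix R₂ N₂ (ZMod 2))
    (χ : (ZMod 1)ˣ) (n k d : ℕ) :
    (code a b χ).IsCode n k d ↔ (hgpCode (b 0) (a 0)).IsCode n k d :=
  CSSCode.isCode_iff_of_submatrix (C := hgpCode (b 0) (a 0)) (C' := code a b χ)
    (xMatrix_eq_hypergraphProduct_submatrix a b χ) (zMatrix_eq_hypergraphProduct_submatrix a b χ) n k d

end COne

end Hyperbicycle


/-! ### `r_i = n_i = 1`: the generalized bicycle codes are recovered (appended 2026-08-27, qec-lit-3 g3) -/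

namespace Hyperbicycle

open Matrix

section ScalarBlocks

variable {c : ℕ} [NeZero c]

/-- Row/column relabelling for scalar blocks: `PUnit × ℤ_c × PUnit ≃ ℤ_c`. Definition.
[cite: KovalevPryadko2013Hyperbicycle, §IV.A (arXiv:1212.6703 chunk p0009 L48-51: "for rᵢ = nᵢ = 1 … we recover the generalized bicycle code construction")] -/
def idxOne (c : ℕ) : PUnit × ZMod c × PUnit ≃ ZMod c :=
  (Equiv.uniqueProd (ZMod c × PUnit) PUnit).trans (Equiv.prodUnique (ZMod c) PUnit)

omit [NeZero c] in
/-- `idxOne (u, k, u') = k`. [cite: KovalevPryadko2013Hyperbicycle, §IV.A (arXiv:1212.6703 chunk p0009 L48-51)] -/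
@[simp] theorem idxOne_apply (u u' : PUnit) (k : ZMod c) : idxOne c (u, k, u') = k := rfl

/-- The GB coefficient vector of the `a`-block: `α_g = a_{−g}` (Mathlib's `circulant v` has entry `(k, j) = v (k − j)`,
KP13's `Σᵢ Iᵢ aᵢ` has entry `a_{j−k}`). Definition.
[cite: KovalevPryadko2013Hyperbicycle, §III.B eq. (Bicycle-1) and §IV.A (arXiv:1212.6703 chunk p0007 L67-80, p0009 L48-51)] -/
def gbA (a : ZMod c → Matrix PUnit PUnit (ZMod 2)) : ZMod c → ZMod 2 :=
  fun g => a (-g) PUnit.unit PUnit.unit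

/-- The GB coefficient vector of the twisted `b`-block: `β_g = b_{χ⁻¹(−g)}`, i.e. the polynomial `b(x^χ)`
(coefficient of `x^{χi}` is `bᵢ`) — the twist acts on a scalar block as the substitution `x ↦ x^χ`
(cf. Wang–Pryadko's map GB ↔ rotated hypergraph-product codes, `b(x) = h₂(x^{n₁})`). Definition.
[cite: KovalevPryadko2013Hyperbicycle, §IV.A (arXiv:1212.6703 chunk p0009 L48-51)]
[cite: WangPryadko2022, §3.3 Statement 10 and proof (arXiv:2203.17216 chunk p0008 L73-96)] -/
def gbB (b : ZMod c → Matrix PUnit PUnit (ZMod 2)) (χ : (ZMod c)ˣ) : ZMod c → ZMod 2 :=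
  fun g => b (↑χ⁻¹ * (-g)) PUnit.unit PUnit.unit

omit [NeZero c] in
/-- **Scalar blocks give the GB check matrix `G_X = (A, B)`**: with `rᵢ = nᵢ = 1` our `G_X` is the abelian
two-block matrix `[circulant α | circulant β]` over `ℤ_c` (`AbelianTwoBlock.HX`, `α = gbA a`, `β = gbB b χ`)
along `idxOne`. Proved. [cite: KovalevPryadko2013Hyperbicycle, §III.B eq. (Bicycle-1), §IV.A (arXiv:1212.6703 chunk p0007 L67-80, p0009 L48-51)] -/
theorem xMatrix_eq_abelianTwoBlock_submatrix (a b : ZMod c → Matrix PUnit PUnit (ZMod 2)) (χ : (ZMod c)ˣ) :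
    xMatrix a b χ =
      (AbelianTwoBlock.HX (gbA a) (gbB b χ)).submatrix (idxOne c) (Equiv.sumCongr (idxOne c) (idxOne c)) := by
  ext ⟨u, k, u'⟩ q
  rcases q with ⟨v, j, v'⟩ | ⟨v, j, v'⟩
  · simp [xMatrix, xLeft, AbelianTwoBlock.HX_def, gbA, circulant_apply, neg_sub]
  · simp [xMatrix, xRight, AbelianTwoBlock.HX_def, gbB, circulant_apply, neg_sub]

omit [NeZero c] in
/-- **Scalar blocks give the GB check matrix `G_Z = (Bᵀ, Aᵀ)`** along `idxOne`. Proved.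
[cite: KovalevPryadko2013Hyperbicycle, §III.B eq. (Bicycle-1), §IV.A (arXiv:1212.6703 chunk p0007 L67-80, p0009 L48-51)] -/
theorem zMatrix_eq_abelianTwoBlock_submatrix (a b : ZMod c → Matrix PUnit PUnit (ZMod 2)) (χ : (ZMod c)ˣ) :
    zMatrix a b χ =
      (AbelianTwoBlock.HZ (gbA a) (gbB b χ)).submatrix (idxOne c) (Equiv.sumCongr (idxOne c) (idxOne c)) := by
  ext ⟨u, k, u'⟩ q
  rcases q with ⟨v, j, v'⟩ | ⟨v, j, v'⟩
  · simp [zMatrix, zLeft, AbelianTwoBlock.HZ_def, gbB, circulant_apply, neg_sub]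
  · simp [zMatrix, zRight, AbelianTwoBlock.HZ_def, gbA, circulant_apply, neg_sub]

/-- **`rᵢ = nᵢ = 1` recovers the generalized bicycle codes**: the hyperbicycle code with scalar blocks is the
GB / abelian two-block CSS code `AbelianTwoBlock.css (gbA a) (gbB b χ)` over `ℤ_c`, re-indexed. Proved.
[cite: KovalevPryadko2013Hyperbicycle, §III.B eq. (Bicycle-1), §IV.A (arXiv:1212.6703 chunk p0007 L67-80, p0009 L48-51)] -/
theorem code_eq_gb_reindex (a b : ZMod c → Matrix PUnit PUnit (ZMod 2)) (χ : (ZMod c)ˣ) :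
    code a b χ = (AbelianTwoBlock.css (gbA a) (gbB b χ)).reindex (idxOne c).symm (idxOne c).symm
      (Equiv.sumCongr (idxOne c) (idxOne c)).symm :=
  CSSCode.eq_reindex_of_submatrix (C := AbelianTwoBlock.css (gbA a) (gbB b χ)) (C' := code a b χ)
    (xMatrix_eq_abelianTwoBlock_submatrix a b χ) (zMatrix_eq_abelianTwoBlock_submatrix a b χ)

/-- `rᵢ = nᵢ = 1`, parameters: the scalar-block hyperbicycle code is `[[n,k,d]]` iff the GB code
`AbelianTwoBlock.css (gbA a) (gbB b χ)` is. Proved.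
[cite: KovalevPryadko2013Hyperbicycle, §IV.A (arXiv:1212.6703 chunk p0009 L48-51)] -/
theorem code_isCode_iff_gb (a b : ZMod c → Matrix PUnit PUnit (ZMod 2)) (χ : (ZMod c)ˣ) (n k d : ℕ) :
    (code a b χ).IsCode n k d ↔ (AbelianTwoBlock.css (gbA a) (gbB b χ)).IsCode n k d :=
  CSSCode.isCode_iff_of_submatrix (C := AbelianTwoBlock.css (gbA a) (gbB b χ)) (C' := code a b χ)
    (xMatrix_eq_abelianTwoBlock_submatrix a b χ) (zMatrix_eq_abelianTwoBlock_submatrix a b χ) n k d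

end ScalarBlocks

end Hyperbicycle

end Literature.InformationTheory.QuantumCodes
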